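import Summits.CriticalPhenomena.SAWScalingLimit.Theorems.MassRatio.Negative.SlabA

/-!
# Crux `MassRatio` (stmt-CriticalPhenomena-8550) — load-bearing hypotheses, part 10: the slab family: boundary edges, bare corridor, `|Z(b₁)| = x_c^{L₁+1}`, SAW, inside, ROWS CLAUSE HOLDS, exhaustion, violation; **`massRatio_false_without_bLimit`** (`δ·mid(b_δ) → b` is load-bearing: a `b_δ` drifting to another flat boundary point can be starved)

Negative knowledge on the crux `MassRatio` (stmt-CriticalPhenomena-8550, route SAWDefectDecoherence r3),
written by the standing disprover (cdisprove, cycles 1–4). The series `MassRatio/Negative/*` does NOT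
refute the crux (verdict: RESISTS — it is a pure exponent bet, predicted ratio `δ^{-25/48}` against the
cut `δ^{-3/4}`); it proves which hypotheses of the crux are LOAD-BEARING (rows clause, `0 < ρ`,
`δ·mid(b_δ) → b`, exhaustion of compacts: each deleted ⇒ FALSE, by explicit admissible families in the
rectangle `D₀ = (-2,2)×(-1,1)` whose boundary mass at the target edge is starved EXACTLY by a bare
corridor), that the hypothesis frame is satisfiable (`massRatio_frame_nonvacuous`), and that the
`Nonempty`-SAW clause is implied by the others. Mechanism throughout: on a bare root-attached corridor
the self-avoiding walk is unique, so `|Z| = x_c^{length}` exactly, while a staircase walk certifies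
`|Z(e₀)| ≥ x_c^{2 iK + 1}` at a mid-edge `e₀` of the compact `Kbox`; `x_c < 3/5` and Bernoulli finish.
-/

namespace Summit.CriticalPhenomena.SAWScalingLimit.Theorems.MassRatio.Negative

open Literature.Probability.LatticeModels Literature.Probability.RandomPlanarGeometry.SAW
open Literature.Probability.RandomPlanarGeometry
open Summit.CriticalPhenomena.SAWScalingLimit.Theses.SAWDefectDecoherence

section SlabFamily

variable {δ : ℝ}

/-- `aE_mem_boundary₁`: slab-family (`Λ₁`) lemma (MassRatio negative series). [folklore] -/
theorem aE_mem_boundary₁ (hδ : 0 < δ) (hδ1 : δ ≤ 1 / 100) : aE δ ∈ hexDomainBoundary (Λ₁ δ) := by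
  obtain ⟨-, hM0, hm10, hPa, hpa, hpb, -, hP100, -⟩ := params hδ hδ1
  refine ⟨(SimpleGraph.mem_edgeSet _).2 (adj_aE δ), bv (mRow δ - 1) (pA δ), bv (mRow δ) (pA δ),
    rfl, ?_, ?_⟩
  · rw [bv_mem_Λ₁ hδ hδ1]; omega
  · rw [bv_mem_Λ₁ hδ hδ1]; omega

/-- `adj_b₁`: slab-family (`Λ₁`) lemma (MassRatio negative series). [folklore] -/
theorem adj_b₁ (δ : ℝ) : hexGraph.Adj (bv (mRow δ) (-6)) (bv (mRow δ) (-5)) := by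
  rw [adj_bv_iff]; left; exact ⟨rfl, Or.inl (by ring)⟩

/-- `b₁_mem_boundary`: slab-family (`Λ₁`) lemma (MassRatio negative series). [folklore] -/
theorem b₁_mem_boundary (hδ : 0 < δ) (hδ1 : δ ≤ 1 / 100) : b₁ δ ∈ hexDomainBoundary (Λ₁ δ) := by
  obtain ⟨-, hM0, hm10, hPa, hpa, hpb, hbP, hP100, -⟩ := params hδ hδ1
  refine ⟨(SimpleGraph.mem_edgeSet _).2 (adj_b₁ δ), bv (mRow δ) (-5), bv (mRow δ) (-6),
    Sym2.eq_swap, ?_, ?_⟩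
  · rw [bv_mem_Λ₁ hδ hδ1]; omega
  · rw [bv_mem_Λ₁ hδ hδ1]; omega

/-- `L₁_eq`: slab-family (`Λ₁`) lemma (MassRatio negative series). [folklore] -/
theorem L₁_eq (hδ : 0 < δ) (hδ1 : δ ≤ 1 / 100) : (L₁ δ : ℤ) = -6 - pA δ := by
  obtain ⟨-, -, -, -, hpa, -⟩ := params hδ hδ1
  unfold L₁; omega

/-- `b₁_eq`: slab-family (`Λ₁`) lemma (MassRatio negative series). [folklore] -/
theorem b₁_eq (hδ : 0 < δ) (hδ1 : δ ≤ 1 / 100) : b₁ δ = s(corr δ (L₁ δ), bv (mRow δ) (-5)) := by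
  have h := L₁_eq hδ hδ1
  simp only [b₁, corr, h]; congr 2; ring

/-- `corr_bare₁`: slab-family (`Λ₁`) lemma (MassRatio negative series). [folklore] -/
theorem corr_bare₁ (hδ : 0 < δ) (hδ1 : δ ≤ 1 / 100) :
    ∀ i, 1 ≤ i → i ≤ L₁ δ → ∀ v ∈ Λ₁ δ, hexGraph.Adj (corr δ i) v →
      v = corr δ (i - 1) ∨ (i < L₁ δ ∧ v = corr δ (i + 1)) := by
  obtain ⟨-, hM0, hm10, hPa, hpa, hpb, hbP, hP100, -⟩ := params hδ hδ1
  have hL := L₁_eq hδ hδ1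
  intro i hi1 hi2 v hv hadj
  have hv' : v = bv (row v) (pos v) := (bv_row_pos v).symm
  rw [hv'] at hv hadj ⊢
  rw [bv_mem_Λ₁ hδ hδ1] at hv
  unfold corr at hadj ⊢
  rw [adj_bv_iff] at hadj
  have hi1' : ((i - 1 : ℕ) : ℤ) = (i : ℤ) - 1 := by omega
  rcases hadj with ⟨h1, h2 | h2⟩ | ⟨h1, h2, -⟩ | ⟨h1, h2, -⟩
  · right
    refine ⟨by omega, ?_⟩
    rw [← h1, h2]; congr 1; push_cast; ring
  · left
    rw [← h1, h2, hi1']; congr 1; ring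
  · exfalso; omega
  · exfalso; omega

/-- **`Z_δ(b''_δ) = x_c^{L₁+1}` exactly.** [folklore] -/
theorem norm_Z_b₁ (hδ : 0 < δ) (hδ1 : δ ≤ 1 / 100) :
    ‖hexParafermionicObservable (Λ₁ δ) (aE δ) hexCriticalFugacity 0 (b₁ δ)‖ =
      hexCriticalFugacity ^ (L₁ δ + 1) := by
  obtain ⟨-, hM0, hm10, hPa, hpa, hpb, hbP, hP100, -⟩ := params hδ hδ1
  have hL := L₁_eq hδ hδ1
  rw [aE_eq, b₁_eq hδ hδ1]
  refine norm_Z_corridor_tip (Λ := Λ₁ δ) (c := corr δ) (L := L₁ δ) ?_ ?_ ?_ ?_ ?_ ?_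
    (corr_bare₁ hδ hδ1) ?_ hexCriticalFugacity_pos_lt_one.1.le
  · intro i hi; unfold corr; rw [bv_mem_Λ₁ hδ hδ1]; omega
  · intro i j _ _ h; unfold corr at h; have := (bv_inj h).2; omega
  · intro i _; unfold corr; rw [adj_bv_iff]; left; exact ⟨rfl, Or.inl (by push_cast; ring)⟩
  · unfold corr; simpa using adj_aE δ
  · rw [bv_mem_Λ₁ hδ hδ1]; omega
  · rw [bv_mem_Λ₁ hδ hδ1]; omega
  · intro h
    unfold corr at h
    rcases Sym2.eq_iff.1 h with ⟨h1, -⟩ | ⟨h1, -⟩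
    · have := (bv_inj h1).1; omega
    · have := (bv_inj h1).1; omega

/-- `nonempty_saw_Λ₁`: slab-family (`Λ₁`) lemma (MassRatio negative series). [folklore] -/
theorem nonempty_saw_Λ₁ (hδ : 0 < δ) (hδ1 : δ ≤ 1 / 100) :
    Nonempty (HexMidEdgeSAW (Λ₁ δ) (aE δ) (b₁ δ)) := by
  obtain ⟨-, hM0, hm10, hPa, hpa, hpb, hbP, hP100, -⟩ := params hδ hδ1
  have hL := L₁_eq hδ hδ1
  rw [aE_eq, b₁_eq hδ hδ1]
  refine ⟨corridorWalk (Λ := Λ₁ δ) (c := corr δ) (L := L₁ δ) ?_ ?_ ?_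
    (by unfold corr; simpa using adj_aE δ) ?_ ?_ ?_⟩
  · intro i hi; unfold corr; rw [bv_mem_Λ₁ hδ hδ1]; omega
  · intro i j _ _ h; unfold corr at h; have := (bv_inj h).2; omega
  · intro i _; unfold corr; rw [adj_bv_iff]; left; exact ⟨rfl, Or.inl (by push_cast; ring)⟩
  · rw [bv_mem_Λ₁ hδ hδ1]; omega
  · rw [bv_mem_Λ₁ hδ hδ1]; omega
  · intro h
    unfold corr at h
    rcases Sym2.eq_iff.1 h with ⟨h1, -⟩ | ⟨h1, -⟩
    · have := (bv_inj h1).1; omega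
    · have := (bv_inj h1).1; omega

/-- `inside_Λ₁`: slab-family (`Λ₁`) lemma (MassRatio negative series). [folklore] -/
theorem inside_Λ₁ (hδ : 0 < δ) (hδ1 : δ ≤ 1 / 100) :
    ∀ v ∈ Λ₁ δ, (δ : ℂ) * hexCenter v ∈ D₀.carrier :=
  fun v hv => inside_ΛR hδ hδ1 v (Λ₁_subset δ hv)

/-- **The rows clause HOLDS for the slab family**: the slab sits at `Re ≤ 0`, outside the unit
ball about `b = 1 - i`. [folklore] -/
theorem rows_Λ₁ (hδ : 0 < δ) (hδ1 : δ ≤ 1 / 100) :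
    ∀ v : HexVertex, (δ : ℂ) * hexCenter v ∈ Metric.ball (D₀.pt 1) 1 →
      (v ∈ Λ₁ δ ↔ mRow δ ≤ v.1 1) := by
  intro v hv
  have hR := rows_ΛR hδ hδ1 v hv
  obtain ⟨h1, -, -, -⟩ := ball_pt1 hv
  rw [re_scaled] at h1
  constructor
  · exact fun h => hR.1 (Λ₁_subset δ h)
  · intro hm
    have hvR := hR.2 hm
    rw [← bv_row_pos v, bv_mem_ΛR] at hvR
    rw [← bv_row_pos v, bv_mem_Λ₁ hδ hδ1]
    left
    refine ⟨hvR.1, hvR.2.1, hvR.2.2.1, hvR.2.2.2, ?_⟩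
    have hpos1 : 0 ≤ pos v := by
      have : (0 : ℝ) < (pos v : ℝ) + 1 := by
        by_contra hcon
        have : δ * ((pos v : ℝ) + 1) ≤ 0 := mul_nonpos_of_nonneg_of_nonpos hδ.le (not_lt.1 hcon)
        linarith
      have : (-1 : ℝ) < pos v := by linarith
      have : -1 < pos v := by exact_mod_cast this
      omega
    omega

/-- `exhaust_Λ₁`: slab-family (`Λ₁`) lemma (MassRatio negative series). [folklore] -/
theorem exhaust_Λ₁ {K : Set ℂ} (hK : IsCompact K) (hKD : K ⊆ D₀.carrier) :
    ∀ᶠ δ : ℝ in nhdsWithin 0 (Set.Ioi 0), ∀ v : HexVertex, (δ : ℂ) * hexCenter v ∈ K →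
      v ∈ Λ₁ δ := by
  filter_upwards [exhaust_rows hK hKD, Ioo_mem_nhdsGT (show (0:ℝ) < 1 / 100 by norm_num)]
    with δ hδ hδ' v hv
  obtain ⟨h1, h2, h3, h4⟩ := hδ v hv
  rw [← bv_row_pos v, bv_mem_Λ₁ hδ'.1 hδ'.2.le]
  exact Or.inl ⟨by omega, h2, h3, h4, by omega⟩

/-- `stair_mem₁`: slab-family (`Λ₁`) lemma (MassRatio negative series). [folklore] -/
theorem stair_mem₁ (hδ : 0 < δ) (hδ1 : δ ≤ 1 / 100) {j : ℕ} (hj : j ≤ 2 * iK δ + 1) :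
    stair δ j ∈ Λ₁ δ := by
  obtain ⟨hiM, hM0, hm10, hPa, hpa, hpb, hbP, hP100, -⟩ := params hδ hδ1
  unfold stair
  rw [bv_mem_Λ₁ hδ hδ1]
  rcases Nat.lt_or_ge j 6 with h6 | h6
  · interval_cases j <;> simp <;> omega
  · left; omega

/-- the staircase walk in the slab family [folklore] -/
noncomputable def stairWalk₁ (hδ : 0 < δ) (hδ1 : δ ≤ 1 / 100) : HexMidEdgeSAW (Λ₁ δ) (aE δ) (e₀ δ) :=
  stairWalkIn (Λ₁ δ) fun _ hj => stair_mem₁ hδ hδ1 hj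

/-- **THE CORE COMPARISON (slab family).** [folklore] -/
theorem Λ₁_violates (C : ℝ) :
    ¬ (∀ᶠ δ : ℝ in nhdsWithin 0 (Set.Ioi 0),
      δ ^ 2 * (∑ᶠ e ∈ {e : Sym2 HexVertex | e ∈ hexDomainMidEdges (Λ₁ δ) ∧
        (δ : ℂ) * hexMidpoint e ∈ Kbox},
        ‖hexParafermionicObservable (Λ₁ δ) (aE δ) hexCriticalFugacity 0 e‖) ≤
      C * δ ^ (-(3 : ℝ) / 4) *
        ‖hexParafermionicObservable (Λ₁ δ) (aE δ) hexCriticalFugacity 0 (b₁ δ)‖) := by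
  intro hev
  have hx0 := hexCriticalFugacity_pos_lt_one.1
  refine endgame hx0 xc_lt.le C (fun δ => 2 * iK δ + 1) (fun δ => L₁ δ - 2 * iK δ)
    (fun δ => iK δ / 2) ?_ ?_
  · filter_upwards [hev, Ioo_mem_nhdsGT (show (0:ℝ) < 1 / 100 by norm_num)] with δ hδ hδ'
    have hδ0 := hδ'.1
    have hδ1 : δ ≤ 1 / 100 := hδ'.2.le
    obtain ⟨-, -, -, -, hpa, hpb, -, -, -, hN, -⟩ := params hδ0 hδ1
    have hL := L₁_eq hδ0 hδ1
    have hE : ({e : Sym2 HexVertex | e ∈ hexDomainMidEdges (Λ₁ δ) ∧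
        (δ : ℂ) * hexMidpoint e ∈ Kbox}).Finite :=
      (hexDomainMidEdges_finite (Λ₁ δ)).subset fun e he => he.1
    have hterm := term_le_finsum_mem hE (f := fun e =>
      ‖hexParafermionicObservable (Λ₁ δ) (aE δ) hexCriticalFugacity 0 e‖) (fun e => norm_nonneg _)
      ⟨e₀_mem_of (stair_mem₁ hδ0 hδ1 (by omega)), e₀_mem_Kbox hδ0 hδ1⟩
    have hwalk := pow_length_le_norm_Z (Λ₁ δ) (aE δ) (e₀ δ) (stairWalk₁ hδ0 hδ1) hx0.le
    rw [stairWalk₁, stairWalkIn_length] at hwalk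
    have hlhs : δ ^ 2 * hexCriticalFugacity ^ (2 * iK δ + 1) ≤
        δ ^ 2 * (∑ᶠ e ∈ {e : Sym2 HexVertex | e ∈ hexDomainMidEdges (Λ₁ δ) ∧
          (δ : ℂ) * hexMidpoint e ∈ Kbox},
          ‖hexParafermionicObservable (Λ₁ δ) (aE δ) hexCriticalFugacity 0 e‖) :=
      mul_le_mul_of_nonneg_left (hwalk.trans hterm) (by positivity)
    rw [norm_Z_b₁ hδ0 hδ1] at hδ
    have hexp : L₁ δ + 1 = 2 * iK δ + 1 + (L₁ δ - 2 * iK δ) := by omega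
    rw [hexp] at hδ
    exact hlhs.trans hδ
  · filter_upwards [Ioo_mem_nhdsGT (show (0:ℝ) < 1 / 100 by norm_num)] with δ hδ'
    have hδ0 := hδ'.1
    have hδ1 : δ ≤ 1 / 100 := hδ'.2.le
    obtain ⟨-, -, -, -, hpa, hpb, -, -, -, hN, hn⟩ := params hδ0 hδ1
    have hL := L₁_eq hδ0 hδ1
    refine ⟨by omega, hn⟩

/-- `MassRatio` with ONLY the hypothesis `δ·mid(b_δ) → b` deleted (everything else verbatim,
including flatness and the rows clause). [folklore] -/
def MassRatioWithoutBLimit : Prop :=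
  ∀ (D : Literature.Probability.RandomPlanarGeometry.DobrushinDomain) (ρ : ℝ)
    (Λ : ℝ → Finset HexVertex) (m : ℝ → ℤ) (a b : ℝ → Sym2 HexVertex),
  let Z : ℝ → Sym2 HexVertex → ℂ := fun δ z =>
    hexParafermionicObservable (Λ δ) (a δ) hexCriticalFugacity 0 z;
  0 < ρ → D.carrier ∩ Metric.ball (D.pt 1) ρ = {z : ℂ | (D.pt 1).im < z.im} ∩ Metric.ball (D.pt 1) ρ →
  (∀ᶠ δ : ℝ in nhdsWithin 0 (Set.Ioi 0), hexDomainSimplyConnected (Λ δ) ∧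
    a δ ∈ hexDomainBoundary (Λ δ) ∧ b δ ∈ hexDomainBoundary (Λ δ) ∧
    Nonempty (HexMidEdgeSAW (Λ δ) (a δ) (b δ)) ∧
    (hexGraph.induce ((Λ δ : Finset HexVertex) : Set HexVertex)).Preconnected ∧
    (∀ v ∈ Λ δ, (δ : ℂ) * hexCenter v ∈ D.carrier) ∧
    (∀ v : HexVertex, (δ : ℂ) * hexCenter v ∈ Metric.ball (D.pt 1) ρ → (v ∈ Λ δ ↔ m δ ≤ v.1 1))) →
  (∀ K : Set ℂ, IsCompact K → K ⊆ D.carrier → ∀ᶠ δ : ℝ in nhdsWithin 0 (Set.Ioi 0),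
    ∀ v : HexVertex, (δ : ℂ) * hexCenter v ∈ K → v ∈ Λ δ) →
  Filter.Tendsto (fun δ : ℝ => (δ : ℂ) * hexMidpoint (a δ)) (nhdsWithin 0 (Set.Ioi 0)) (nhds (D.pt 0)) →
  ∀ K : Set ℂ, IsCompact K → K ⊆ D.carrier → ∃ C : ℝ, ∀ᶠ δ : ℝ in nhdsWithin 0 (Set.Ioi 0),
    δ ^ 2 * (∑ᶠ e ∈ {e : Sym2 HexVertex | e ∈ hexDomainMidEdges (Λ δ) ∧
      (δ : ℂ) * hexMidpoint e ∈ K}, ‖Z δ e‖) ≤ C * δ ^ (-(3 : ℝ) / 4) * ‖Z δ (b δ)‖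

/-- `frame_Λ₁`: slab-family (`Λ₁`) lemma (MassRatio negative series). [folklore] -/
theorem frame_Λ₁ : ∀ᶠ δ : ℝ in nhdsWithin 0 (Set.Ioi 0), hexDomainSimplyConnected (Λ₁ δ) ∧
    aE δ ∈ hexDomainBoundary (Λ₁ δ) ∧ b₁ δ ∈ hexDomainBoundary (Λ₁ δ) ∧
    Nonempty (HexMidEdgeSAW (Λ₁ δ) (aE δ) (b₁ δ)) ∧
    (hexGraph.induce ((Λ₁ δ : Finset HexVertex) : Set HexVertex)).Preconnected ∧
    (∀ v ∈ Λ₁ δ, (δ : ℂ) * hexCenter v ∈ D₀.carrier) ∧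
    (∀ v : HexVertex, (δ : ℂ) * hexCenter v ∈ Metric.ball (D₀.pt 1) 1 →
      (v ∈ Λ₁ δ ↔ mRow δ ≤ v.1 1)) := by
  filter_upwards [Ioo_mem_nhdsGT (show (0:ℝ) < 1 / 100 by norm_num)] with δ hδ
  obtain ⟨hδ0, hδ1⟩ := hδ
  exact ⟨simplyConnected_Λ₁ hδ0 hδ1.le, aE_mem_boundary₁ hδ0 hδ1.le, b₁_mem_boundary hδ0 hδ1.le,
    nonempty_saw_Λ₁ hδ0 hδ1.le, preconnected_Λ₁ hδ0 hδ1.le, inside_Λ₁ hδ0 hδ1.le, rows_Λ₁ hδ0 hδ1.le⟩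

/-- **`b_δ → b` is load-bearing: `MassRatio` without it is FALSE**, even with flatness and the
rows clause in force. Witness: `D₀`, `ρ = 1`, the slab family `Λ₁`, `m_δ = mRow δ`, `a_δ = aE δ`,
`b''_δ = b₁ δ` (converging to `-i`, a flat boundary point OUTSIDE the protected ball), `K = Kbox`. [folklore] -/
theorem massRatio_false_without_bLimit : ¬ MassRatioWithoutBLimit := by
  intro h
  obtain ⟨C, hC⟩ := h D₀ 1 Λ₁ mRow aE b₁ one_pos D₀_flat frame_Λ₁ (fun K hK hKD => exhaust_Λ₁ hK hKD)
    tendsto_aE Kbox Kbox_compact Kbox_sub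
  exact Λ₁_violates C hC

end SlabFamily

end Summit.CriticalPhenomena.SAWScalingLimit.Theorems.MassRatio.Negative
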